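import Summits.QuantumFields.YangMills.Theorems.BalabanUVNodesN07FaceDatumGeometry
import Literature.MathematicalPhysics.QuantumFieldTheory.Balaban1983to89.Node00.Record12BgRowCoClassC
import Literature.MathematicalPhysics.QuantumFieldTheory.Balaban1983to89.B10Eq2DensityTower
import Literature.MathematicalPhysics.QuantumFieldTheory.Balaban1983to89.B16Thm1BaseAtRecord11

/-!
# BalabanUVNodes ∕ N07 ([Balaban1985Variational] Thm 1 (6)–(8) ∕ Prop. 8 p. 304) — def-P11's C′ fact `VariationalThm1RegSepCo7` FROM THE STEP FORM OF
# PROPOSITION 8 (`Node00.Prop8RegSepStep`, `k ≥ 1`), the step `k = 0` being the FLAT unconstrained minimiser (no Prop. 8 needed there)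

Cell `pub-ymgap`, seat `pub-ymgap-dag-n07-e` generation 8 (R141 (C), DAG node N07 = [15]; ROW P11; this seat's LOCATED-M5 «k = 0 is unconstrained» on its own
`Prop8RegSepPrinted`, repaired as `Prop8RegSepStep` in `Node00/CriticalOnFibre.lean` v1.1).  `--kind proof --supports stmt-QuantumFields-20289 --as helper`.
THEOREMS ONLY (0 `def`, 0 `sorry`).

WHAT THIS FILE DOES.  At `k = 0` the tree's determining set is empty (`B16Thm1BaseAtRecord11.genSet_seq_zero` ∕ `agreeOn_genSet_seq_zero`, cited:
`gammaRegion Ω 0 0 = Ω 0 = ∅` by `Seq.Ω_off`), so a (2.12) minimiser over print's class (6) is an UNCONSTRAINED minimiser of the Wilson action in a class containing `1`: its action is `0`, every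
plaquette is `1` (`dist1 = 0`), its co-divergence vanishes — the conclusion (8) holds with room (`0 < B₃δ_n`).  Hence ★ `variationalThm1RegSepCo7_of_prop8Step
(hB : 0 < B₃) : Prop8RegSepStep F N B₃ a₀ a₁ → VariationalThm1RegSepCo7 F N B₃ a₀ a₁` — def-P11 FILE 11's `variationalThm1RegSepCo7_of_prop8` re-keyed on the
STEP form (the un-stepped `Prop8RegSepPrinted` is located-refutable at `k = 0`, M5; `0 < B₃` is implied by every consumer's displayed floor `2L² ≤ B₃`).

HONEST FRAMING: count-neutral kernel bookkeeping; Prop. 8 NOT claimed; nothing of Bałaban asserted; N07 ∕ K0⁗ NOT discharged (5∕27); one finite T⁴ programme at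
fixed ε — NOT continuum ∕ ℝ⁴ ∕ OS ∕ mass gap ∕ Clay.

DEPENDENCES (by name): `Node00.(Prop8RegSepStep, regular_of_isMinimizer_class6_of_prop8Step)` (this seat, `CriticalOnFibre` v1.1), def-P11 FILE 11
`Node00.VariationalThm1RegSepCo7`, part A1 `norm_coDivSum_le`, 19a `dist1_plaqHol_sq_le_wilsonAction4`, `B10Eq2DensityTower.wilsonAction4_one`, r12
`B16Thm1BaseAtRecord11.agreeOn_genSet_seq_zero` (the empty determining set at `k = 0`, cited not restated).
-/

noncomputable section

namespace Summit.QuantumFields.YangMills.BalabanUVNodes.N07Thm1Co7FromProp8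

open Literature.MathematicalPhysics.QuantumFieldTheory.Balaban1983to89
open Literature.MathematicalPhysics.QuantumFieldTheory.Balaban1983to89.T4Continuum (T4Family)
open Literature.MathematicalPhysics.QuantumFieldTheory.Balaban1983to89.Node00
open Literature.MathematicalPhysics.QuantumFieldTheory.Balaban1983to89.B15DeterminingSets
open Summit.QuantumFields.YangMills.BalabanUVNodes.N07SmallActionBoundaryAvoidance (dist1_plaqHol_sq_le_wilsonAction4)
open Summit.QuantumFields.YangMills.BalabanUVNodes.N07FaceDatumAverage (norm_coDivSum_le)
open scoped Matrix.Norms.L2Operator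

variable {F : T4Family} {N : ℕ} [NeZero N]

/-- **AT `k = 0` A MINIMISER OVER PRINT'S CLASS (6) IS FLAT**: the class contains `1` (`ε₀ > 0`), the fibre is everything, so `A(U₀) ≤ A(1) = 0` and every
plaquette of `U₀` has `dist1 = 0`. [cite: Balaban1985Variational, (5)–(6) p.278; Balaban1985RegularSpaces, (1.10) p.77] -/
theorem dist1_plaqHol_eq_zero_of_isMinimizer_zero {ν : Stage7Numerics} {M : ℕ} {g : ℕ → ℝ} {K : ℕ} (s : SeqOfRecord F ν M g K 0) {ε₀ : ℝ}
    (hε₀ : 0 < ε₀) {W : MSField (F.P K) (SU N)} {U₀ : GaugeField (F.P K) 0 (SU N)}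
    (hU₀ : IsMinimizer (avOfRecord F N K)
      {U | (∀ n, n ≤ 0 → PlaqSmallOn (omegaPlaqs s.Ω n) (ε₀ * (F.P K).eta n ^ 2) U) ∧ Sect2.CoDivClassOn s.Ω 0 ε₀ U} (genSet s.Ω 0) W U₀)
    (q : Plaq (F.P K) 0) : dist1 (GaugeField.plaqHol U₀ q) = 0 := by
  have hη : ∀ n, 0 < (F.P K).eta n := fun n => pow_pos (inv_pos.mpr (by exact_mod_cast (F.P K).L_pos)) n
  have h1plaq : ∀ q : Plaq (F.P K) 0, dist1 (GaugeField.plaqHol (1 : GaugeField (F.P K) 0 (SU N)) q) ≤ 0 := fun q => by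
    show dist1 ((1 : SU N) * 1 * 1⁻¹ * 1⁻¹) ≤ 0
    rw [inv_one, mul_one, mul_one, mul_one, GaugeGroup.dist1_one]
  have h1 : (1 : GaugeField (F.P K) 0 (SU N)) ∈
      {U | (∀ n, n ≤ 0 → PlaqSmallOn (omegaPlaqs s.Ω n) (ε₀ * (F.P K).eta n ^ 2) U) ∧ Sect2.CoDivClassOn s.Ω 0 ε₀ U} := by
    refine ⟨fun n _ q _ => (h1plaq q).trans_lt (mul_pos hε₀ (pow_pos (hη n) 2)), fun j _ b _ => ?_⟩
    have h := norm_coDivSum_le (1 : GaugeField (F.P K) 0 (SU N)) le_rfl h1plaq b.src b.dir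
    rw [mul_zero, mul_zero] at h
    exact h.trans_lt (mul_pos hε₀ (pow_pos (hη j) 3))
  have hA : wilsonAction4 U₀ ≤ 0 := by
    have h := hU₀.2.2 1 h1 (B16Thm1BaseAtRecord11.agreeOn_genSet_seq_zero F N s _ _)
    have h0 : wilsonAction4 (1 : GaugeField (F.P K) 0 (SU N)) = 0 := B10Eq2DensityTower.wilsonAction4_one
    linarith
  have hsq := dist1_plaqHol_sq_le_wilsonAction4 U₀ q
  have hN : (0 : ℝ) ≤ 2 * N := by positivity
  have h2 : 2 * (N : ℝ) * wilsonAction4 U₀ ≤ 0 := mul_nonpos_of_nonneg_of_nonpos hN hA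
  have h3 : dist1 (GaugeField.plaqHol U₀ q) ^ 2 = 0 := le_antisymm (hsq.trans h2) (sq_nonneg _)
  exact pow_eq_zero_iff (two_ne_zero) |>.mp h3

/-- ★ **DEF-P11's C′ FACT FROM THE STEP FORM OF PROPOSITION 8**: for `0 < B₃`, `Prop8RegSepStep F N B₃ a₀ a₁ → VariationalThm1RegSepCo7 F N B₃ a₀ a₁` — at a
genuine step by `regular_of_isMinimizer_class6_of_prop8Step` (minimal over the open class (6) ⇒ critical on the fibre ⇒ Prop. 8), at `k = 0` by flatness of
the unconstrained minimiser. [cite: Balaban1985Variational, Thm 1 (6)–(8) pp.278–279, p.299, Prop. 8 p.304; Balaban1988Convergent, (2.12) p.256] -/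
theorem variationalThm1RegSepCo7_of_prop8Step {B₃ a₀ a₁ : ℝ} (hB : 0 < B₃) (h8 : Prop8RegSepStep F N B₃ a₀ a₁) :
    VariationalThm1RegSepCo7 F N B₃ a₀ a₁ := by
  intro ν M g K k s hsep ε₀ δ hδ hcomp hcomp' hε₀ W h7 U₀ hU₀
  rcases Nat.eq_zero_or_pos k with rfl | hk
  · -- `k = 0`: the unconstrained minimiser is flat
    have hε₀pos : 0 < ε₀ := lt_of_lt_of_le (mul_pos hB (hδ 0 le_rfl).1) (hδ 0 le_rfl).2.2
    have hη : ∀ n, 0 < (F.P K).eta n := fun n => pow_pos (inv_pos.mpr (by exact_mod_cast (F.P K).L_pos)) n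
    have hflat : ∀ q, dist1 (GaugeField.plaqHol U₀ q) ≤ 0 := fun q => le_of_eq (dist1_plaqHol_eq_zero_of_isMinimizer_zero s hε₀pos hU₀ q)
    refine ⟨fun n hn q _ => (hflat q).trans_lt (mul_pos (mul_pos hB (hδ n hn).1) (pow_pos (hη n) 2)), fun n hn b _ => ?_⟩
    have h := norm_coDivSum_le U₀ le_rfl hflat b.src b.dir
    rw [mul_zero, mul_zero] at h
    exact h.trans_lt (mul_pos (mul_pos hB (hδ n hn).1) (pow_pos (hη n) 3))
  · exact regular_of_isMinimizer_class6_of_prop8Step h8 ν M g K k s hsep hk ε₀ δ hδ hcomp hcomp' hε₀ W h7 hU₀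

end Summit.QuantumFields.YangMills.BalabanUVNodes.N07Thm1Co7FromProp8

end
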